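import Mathlib
import HarnessLib

/-!
# Route `RadicialJung`, crux `CleanModels` (stmt-ResolutionOfSingularities-15917), line `Sketch` rev 35, stub 6 `stub_cleanProp44` (X44c),
# work plan O8 / L7b-global, residual (b): a DEFICIENT prime makes the radicial cover singular

Memo `Cruxes/CleanModels/Lines/Sketch-memo-hand2-g9-stubs-5-7.md` §3a/§3b: after ✓ `exists_rep_not_mem_forall_cleanPermissibleAt_or_deficient_of_generic_unit`
(p816913) the one non-mechanical point of L7b-global is the finiteness of the DEFICIENT points of the curve: the primes `𝔮` of its
coordinate ring `D` (char `p`) at which the unit representative `v` is a `p`-th power modulo `𝔮² D_𝔮`, i.e. `s^p v − e^p ∈ 𝔮²` for some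
`s ∉ 𝔮`.  KEY OBSERVATION (this file, pure algebra): deficiency at a maximal `𝔮` forces the RADICIAL COVER `E := D[x]/(x^p − v)` to be
SINGULAR above `𝔮`: for every prime `𝔑` of `E` over `𝔮`, the maximal ideal of `E_𝔑` is NOT principal (`E_𝔑` is one-dimensional when
`dim D = 1`, so it is not regular).  Proof: if `𝔪_{E_𝔑} = (g)`, map `E_𝔑` to the trivial square-zero extension `T = R ⊕ Rε` of
`R := D/𝔮²` by `x ↦ e/s + ε` — a ring map because `(e/s + ε)^p = (e/s)^p = v` in `R` (deficiency), inverting `E ∖ 𝔑` because followed by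
`R → D/𝔮 ↪ E/𝔑` it is the reduction modulo `𝔑`; the images `π·1` (`π ∈ 𝔮 ∖ 𝔮²`) and `s·ε` (of `s x − e`) of two elements of `𝔪_{E_𝔑}` are
multiples of the image of `g`, whose first component lies in the square-zero ideal `𝔮/𝔮²`, and a two-line computation in `T`
(`tsze_eq_zero_of_inr_one_eq_mul`) gives `π ∈ 𝔮²`.  The finiteness of the deficiency set (J-2: the singular locus of `E` is closed and misses
the generic fibre `Frac(D)(v^{1/p})`, a field) is drawn from this in `…DeficiencyFinite.lean`.

Honest framing: OURS (elementary commutative algebra — the tangent-space computation behind «`A[x]/(x^p − u)` is regular above `𝔮` iff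
the contact `max_c ord_𝔮(u − c^p)` is `≤ 1`»); nothing here proves X44c or any case of `CleanModels`.
-/

noncomputable section

set_option linter.dupNamespace false -- mandated namespace of this single-conjunct summit

open IsLocalRing Polynomial TrivSqZeroExt

namespace Summit.ResolutionOfSingularities.ResolutionOfSingularities.Theorems.RadicialJung.CleanModels

universe u

/-- In the trivial square-zero extension `T = R ⊕ R ε` (`ε = inr 1`): if `ε` and `inl r` are both multiples of an element `g` whose first
component lies in an ideal `J` of square zero, then `r = 0`.  (From `ε = b g`: `b₀ g₀ = 0` and `b₀ g₁ + b₁ g₀ = 1`, whence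
`g₀ = g₀ (b₀ g₁ + b₁ g₀) = 0`; then `r = a₀ g₀ = 0`.) -/
theorem tsze_eq_zero_of_inr_one_eq_mul {R : Type u} [CommRing R] {J : Ideal R} (hJ : J * J = ⊥) {g b a : TrivSqZeroExt R R}
    (hg : g.fst ∈ J) (hε : (inr 1 : TrivSqZeroExt R R) = b * g) {r : R} (hr : (inl r : TrivSqZeroExt R R) = a * g) : r = 0 := by
  have h1 : b.fst * g.fst = 0 := by
    have := congrArg fst hε
    rwa [fst_inr, fst_mul, eq_comm] at this
  have h2 : b.fst * g.snd + b.snd * g.fst = 1 := by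
    have := congrArg snd hε
    rw [snd_inr, snd_mul, smul_eq_mul, op_smul_eq_mul] at this
    exact this.symm
  have hg0 : g.fst * g.fst = 0 := by
    have : g.fst * g.fst ∈ J * J := Ideal.mul_mem_mul hg hg
    rwa [hJ, Ideal.mem_bot] at this
  have h3 : g.fst = 0 := by
    calc g.fst = g.fst * (b.fst * g.snd + b.snd * g.fst) := by rw [h2, mul_one]
      _ = g.snd * (b.fst * g.fst) + b.snd * (g.fst * g.fst) := by ring
      _ = 0 := by rw [h1, hg0, mul_zero, mul_zero, add_zero]
  have := congrArg fst hr
  rwa [fst_inl, fst_mul, h3, mul_zero] at this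

/-- Two ring maps out of `AdjoinRoot f` agreeing on the constants and on the root are equal. -/
theorem adjoinRoot_ringHom_ext {D S : Type u} [CommRing D] [CommRing S] {f : D[X]} {g₁ g₂ : AdjoinRoot f →+* S}
    (hC : ∀ d : D, g₁ (AdjoinRoot.of f d) = g₂ (AdjoinRoot.of f d)) (hX : g₁ (AdjoinRoot.root f) = g₂ (AdjoinRoot.root f)) :
    g₁ = g₂ := by
  refine Ideal.Quotient.ringHom_ext (Polynomial.ringHom_ext (fun d => ?_) ?_)
  · exact hC d
  · exact hX

/-- In `D ⧸ 𝔮 ^ 2` with `𝔮` maximal, the class of an element outside `𝔮` is a unit. -/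
theorem isUnit_mk_sq_of_not_mem {D : Type u} [CommRing D] {𝔮 : Ideal D} (h𝔮 : 𝔮.IsMaximal) {d : D} (hd : d ∉ 𝔮) :
    IsUnit (Ideal.Quotient.mk (𝔮 ^ 2) d) := by
  haveI := h𝔮
  obtain ⟨y, i, hi, hyi⟩ := Ideal.IsMaximal.exists_inv_pow 𝔮 hd 2
  refine IsUnit.of_mul_eq_one (Ideal.Quotient.mk (𝔮 ^ 2) y) ?_
  rw [← map_mul, ← (Ideal.Quotient.mk (𝔮 ^ 2)).map_one, Ideal.Quotient.eq]
  have : d * y - 1 = -i := by linear_combination hyi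
  rw [this]
  exact (𝔮 ^ 2).neg_mem hi

/-- **A deficient prime makes the radicial cover singular.**  `D` a domain of characteristic `p`, `v ∈ D`, `E = D[x]/(x^p − v)`
(`AdjoinRoot f`, `f = X^p − C v`), `𝔑` a prime of `E` whose contraction `𝔮` to `D` is maximal.  If `v` is DEFICIENT at `𝔮` — `s^p v − e^p ∈ 𝔮²`
for some `s ∉ 𝔮` — and `𝔮 ≠ 𝔮²` (witnessed by `π ∈ 𝔮 ∖ 𝔮²`), then the maximal ideal of `E_𝔑` is not principal.  See the module
docstring for the proof (a tangent-vector computation in `D/𝔮² ⊕ (D/𝔮²)ε`). -/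
theorem not_isPrincipal_maximalIdeal_of_deficient (p : ℕ) [hp : Fact p.Prime] {D : Type u} [CommRing D] [IsDomain D] [CharP D p]
    (v : D) {f : D[X]} (hfdef : f = X ^ p - C v) (𝔑 : Ideal (AdjoinRoot f)) [h𝔑 : 𝔑.IsPrime]
    (h𝔮 : (𝔑.comap (algebraMap D (AdjoinRoot f))).IsMaximal) {s e π : D} (hs : s ∉ 𝔑.comap (algebraMap D (AdjoinRoot f)))
    (hse : s ^ p * v - e ^ p ∈ 𝔑.comap (algebraMap D (AdjoinRoot f)) ^ 2) (hπ : π ∈ 𝔑.comap (algebraMap D (AdjoinRoot f)))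
    (hπ2 : π ∉ 𝔑.comap (algebraMap D (AdjoinRoot f)) ^ 2) :
    ¬ (maximalIdeal (Localization.AtPrime 𝔑)).IsPrincipal := by
  classical
  set 𝔮 : Ideal D := 𝔑.comap (algebraMap D (AdjoinRoot f)) with h𝔮def
  intro hprinc
  have hp' : p.Prime := hp.out
  have hf : f.Monic := by rw [hfdef]; exact monic_X_pow_sub_C v hp'.ne_zero
  haveI : Module.Finite D (AdjoinRoot f) := hf.finite_adjoinRoot
  haveI : Algebra.IsIntegral D (AdjoinRoot f) := inferInstance
  haveI h𝔑max : 𝔑.IsMaximal := Ideal.isMaximal_of_isIntegral_of_isMaximal_comap 𝔑 h𝔮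
  haveI := h𝔮
  letI : Field (D ⧸ 𝔮) := Ideal.Quotient.field 𝔮
  letI : Field (AdjoinRoot f ⧸ 𝔑) := Ideal.Quotient.field 𝔑
  have halg : ∀ d : D, algebraMap D (AdjoinRoot f) d = AdjoinRoot.of f d := fun d => rfl
  have hdegf : f.degree ≠ 0 := by
    rw [hfdef, degree_X_pow_sub_C hp'.pos]; exact_mod_cast hp'.ne_zero
  haveI : Nontrivial (AdjoinRoot f) := AdjoinRoot.nontrivial f hdegf
  haveI : CharP (AdjoinRoot f) p := CharP.of_ringHom_of_ne_zero (AdjoinRoot.of f) p hp'.ne_zero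
  -- the root
  have hroot : (AdjoinRoot.root f) ^ p = AdjoinRoot.of f v := by
    have h0 : (X ^ p - C v : D[X]).eval₂ (AdjoinRoot.of f) (AdjoinRoot.root f) = 0 := by
      rw [← hfdef]; exact AdjoinRoot.eval₂_root f
    rwa [eval₂_sub, eval₂_X_pow, eval₂_C, sub_eq_zero] at h0
  -- `n₁ := s x − e ∈ 𝔑`
  set n₁ : AdjoinRoot f := AdjoinRoot.of f s * AdjoinRoot.root f - AdjoinRoot.of f e with hn₁def
  have hn₁p : n₁ ^ p = AdjoinRoot.of f (s ^ p * v - e ^ p) := by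
    rw [hn₁def, sub_pow_char, mul_pow, hroot, map_sub, map_mul, map_pow, map_pow]
  have hn₁ : n₁ ∈ 𝔑 := by
    refine h𝔑.mem_of_pow_mem p ?_
    rw [hn₁p, ← halg, ← Ideal.mem_comap]
    exact Ideal.pow_le_self two_ne_zero hse
  -- `R := D ⧸ 𝔮²`, `J := 𝔮/𝔮²`, the class `a` of `e/s`
  set R := D ⧸ 𝔮 ^ 2 with hRdef
  set mkR : D →+* R := Ideal.Quotient.mk (𝔮 ^ 2) with hmkR
  set J : Ideal R := 𝔮.map mkR with hJdef
  have hJ2 : J * J = ⊥ := by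
    rw [hJdef, ← Ideal.map_mul, ← pow_two, hmkR, Ideal.map_quotient_self]
  have hsu : IsUnit (mkR s) := isUnit_mk_sq_of_not_mem h𝔮 hs
  set a : R := mkR e * ↑(hsu.unit⁻¹) with hadef
  have hsa : mkR s * a = mkR e := by
    rw [hadef, mul_left_comm, IsUnit.mul_val_inv, mul_one]
  have hap : a ^ p = mkR v := by
    -- `s^p a^p = e^p = s^p v` in `R`, and `s` is a unit
    have h1 : mkR s ^ p * a ^ p = mkR s ^ p * mkR v := by
      rw [← mul_pow, hsa, ← map_pow, ← map_pow, ← map_mul, eq_comm, ← sub_eq_zero, ← map_sub, hmkR,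
        Ideal.Quotient.eq_zero_iff_mem]
      exact hse
    exact (hsu.pow p).mul_left_cancel h1
  -- `T := R ⊕ R ε` and `χ₀ : E → T`, `x ↦ a + ε`
  set T := TrivSqZeroExt R R with hTdef
  set i₀ : D →+* T := (TrivSqZeroExt.inlHom R R).comp mkR with hi₀def
  have hi₀ : ∀ d : D, i₀ d = inl (mkR d) := fun d => rfl
  set uT : T := inl a + inr 1 with huTdef
  have huTp : uT ^ p = inl (a ^ p) := by
    refine TrivSqZeroExt.ext ?_ ?_
    · rw [fst_pow, huTdef, fst_add, fst_inl, fst_inr, add_zero, fst_inl]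
    · rw [snd_pow, huTdef, fst_add, fst_inl, fst_inr, add_zero, snd_add, snd_inl, snd_inr, zero_add, snd_inl,
        smul_eq_mul, mul_one, nsmul_eq_mul]
      have : (p : R) = 0 := by rw [← map_natCast mkR p, CharP.cast_eq_zero, map_zero]
      rw [this, zero_mul]
  have hev : f.eval₂ i₀ uT = 0 := by
    rw [hfdef, eval₂_sub, eval₂_X_pow, eval₂_C, huTp, hi₀, hap, sub_self]
  set χ₀ : AdjoinRoot f →+* T := AdjoinRoot.lift i₀ uT hev with hχ₀def
  have hχ₀of : ∀ d : D, χ₀ (AdjoinRoot.of f d) = inl (mkR d) := fun d => by rw [hχ₀def, AdjoinRoot.lift_of, hi₀]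
  have hχ₀root : χ₀ (AdjoinRoot.root f) = uT := by rw [hχ₀def, AdjoinRoot.lift_root]
  -- `ω := fst ∘ χ₀ : E → R`, `red : R → D/𝔮`, `ι : D/𝔮 → E/𝔑`
  set ω : AdjoinRoot f →+* R := (TrivSqZeroExt.fstHom R R R).toRingHom.comp χ₀ with hωdef
  have hω : ∀ t, ω t = (χ₀ t).fst := fun t => rfl
  set red : R →+* D ⧸ 𝔮 := Ideal.Quotient.factor (Ideal.pow_le_self two_ne_zero) with hreddef
  have hred : ∀ d : D, red (mkR d) = Ideal.Quotient.mk 𝔮 d := fun d => by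
    rw [hreddef, hmkR, Ideal.Quotient.factor_mk]
  have hle : 𝔮 ≤ 𝔑.comap (AdjoinRoot.of f) := le_of_eq h𝔮def
  set ι : D ⧸ 𝔮 →+* AdjoinRoot f ⧸ 𝔑 := Ideal.quotientMap 𝔑 (AdjoinRoot.of f) hle with hιdef
  have hιinj : Function.Injective ι := Ideal.quotientMap_injective' (le_of_eq h𝔮def.symm)
  -- the reduction modulo `𝔑` factors as `ι ∘ red ∘ ω`
  have hkey : (ι.comp (red.comp ω)) = Ideal.Quotient.mk 𝔑 := by
    refine adjoinRoot_ringHom_ext (fun d => ?_) ?_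
    · rw [RingHom.comp_apply, RingHom.comp_apply, hω, hχ₀of, fst_inl, hred, hιdef, Ideal.quotientMap_mk]
    · rw [RingHom.comp_apply, RingHom.comp_apply, hω, hχ₀root, huTdef, fst_add, fst_inl, fst_inr, add_zero]
      -- in the field `E/𝔑`: `ι(s̄) · x̄ = ι(ē)`, from `(s x − e)^p ∈ 𝔑`
      have hsx : ι (Ideal.Quotient.mk 𝔮 s) * Ideal.Quotient.mk 𝔑 (AdjoinRoot.root f) = ι (Ideal.Quotient.mk 𝔮 e) := by
        rw [hιdef, Ideal.quotientMap_mk, Ideal.quotientMap_mk, ← map_mul, ← sub_eq_zero, ← map_sub,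
          Ideal.Quotient.eq_zero_iff_mem]
        exact hn₁
      have hsι : ι (Ideal.Quotient.mk 𝔮 s) ≠ 0 := by
        rw [map_ne_zero_iff ι hιinj, Ne, Ideal.Quotient.eq_zero_iff_mem]; exact hs
      have hreda : red a = Ideal.Quotient.mk 𝔮 e * (Ideal.Quotient.mk 𝔮 s)⁻¹ := by
        have hs0 : Ideal.Quotient.mk 𝔮 s ≠ 0 := by rw [Ne, Ideal.Quotient.eq_zero_iff_mem]; exact hs
        rw [eq_mul_inv_iff_mul_eq₀ hs0, mul_comm, ← hred s, ← map_mul, hsa, hred]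
      rw [hreda, map_mul, map_inv₀, ← hsx, mul_comm (ι _), mul_inv_cancel_right₀ hsι]
  have hkey' : ∀ t, Ideal.Quotient.mk 𝔑 t = ι (red (ω t)) := fun t => by rw [← hkey]; rfl
  -- consequences: `t ∈ 𝔑 ↔ ω t ∈ J`
  have hωJ : ∀ t, t ∈ 𝔑 ↔ ω t ∈ J := by
    intro t
    rw [← Ideal.Quotient.eq_zero_iff_mem, hkey', map_eq_zero_iff ι hιinj]
    obtain ⟨d, hd⟩ := Ideal.Quotient.mk_surjective (ω t)
    rw [← hmkR] at hd
    rw [← hd, hred, Ideal.Quotient.eq_zero_iff_mem, hJdef]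
    constructor
    · exact fun h => Ideal.mem_map_of_mem _ h
    · intro h
      rw [Ideal.mem_map_iff_of_surjective _ Ideal.Quotient.mk_surjective] at h
      obtain ⟨d', hd', hdd'⟩ := h
      rw [hmkR, Ideal.Quotient.eq] at hdd'
      have : d = d' - (d' - d) := by ring
      rw [this]
      exact 𝔮.sub_mem hd' (Ideal.pow_le_self two_ne_zero hdd')
  have hωunit : ∀ t, t ∉ 𝔑 → IsUnit (χ₀ t) := by
    intro t ht
    rw [TrivSqZeroExt.isUnit_iff_isUnit_fst, ← hω]
    obtain ⟨d, hd⟩ := Ideal.Quotient.mk_surjective (ω t)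
    rw [← hmkR] at hd
    have hd𝔮 : d ∉ 𝔮 := by
      intro hd𝔮
      exact ht ((hωJ t).mpr (by rw [← hd, hJdef]; exact Ideal.mem_map_of_mem _ hd𝔮))
    rw [← hd]
    exact isUnit_mk_sq_of_not_mem h𝔮 hd𝔮
  -- `χ : E_𝔑 → T`
  set S := Localization.AtPrime 𝔑 with hSdef
  set ψ := algebraMap (AdjoinRoot f) S with hψdef
  have hunits : ∀ y : 𝔑.primeCompl, IsUnit (χ₀ y) := fun y => hωunit y.1 y.2
  set χ : S →+* T := IsLocalization.lift (M := 𝔑.primeCompl) hunits with hχdef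
  have hχψ : ∀ t, χ (ψ t) = χ₀ t := fun t => IsLocalization.lift_eq hunits t
  -- the images of `𝔪_S` have first component in `J`
  have hmS : maximalIdeal S = 𝔑.map ψ := (Localization.AtPrime.map_eq_maximalIdeal).symm
  have hfstJ : ∀ z ∈ maximalIdeal S, (χ z).fst ∈ J := by
    intro z hz
    have h1 : (maximalIdeal S).map χ ≤ J.comap (TrivSqZeroExt.fstHom R R R).toRingHom := by
      rw [hmS, Ideal.map_map, Ideal.map_le_iff_le_comap]
      intro n hn
      rw [Ideal.mem_comap, Ideal.mem_comap, RingHom.comp_apply, hχψ]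
      exact (hωJ n).mp hn
    exact h1 (Ideal.mem_map_of_mem χ hz)
  -- the generator
  obtain ⟨g₀, hg₀⟩ := hprinc
  have hg₀mem : g₀ ∈ maximalIdeal S := by rw [hg₀]; exact Ideal.mem_span_singleton_self g₀
  have hmul : ∀ z ∈ maximalIdeal S, ∃ c : S, z = c * g₀ := fun z hz => by
    rw [hg₀] at hz; exact Ideal.mem_span_singleton'.mp hz |>.imp fun c hc => hc.symm
  -- `π · 1 ∈ (χ g₀)`
  have hπS : ψ (AdjoinRoot.of f π) ∈ maximalIdeal S := by
    rw [hmS]; exact Ideal.mem_map_of_mem ψ (by rw [← halg, ← Ideal.mem_comap]; exact hπ)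
  obtain ⟨cπ, hcπ⟩ := hmul _ hπS
  have hπT : (inl (mkR π) : T) = χ cπ * χ g₀ := by rw [← map_mul, ← hcπ, hχψ, hχ₀of]
  -- `ε ∈ (χ g₀)`
  have hn₁S : ψ n₁ ∈ maximalIdeal S := by rw [hmS]; exact Ideal.mem_map_of_mem ψ hn₁
  obtain ⟨c₁, hc₁⟩ := hmul _ hn₁S
  have hn₁T : χ₀ n₁ = inl (mkR s) * inr 1 := by
    rw [hn₁def, map_sub, map_mul, hχ₀of, hχ₀root, hχ₀of, huTdef, mul_add, ← sub_add_eq_add_sub, inl_mul_inl, hsa, sub_self,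
      zero_add]
  have hεT : (inr 1 : T) = (inl (↑(hsu.unit⁻¹) : R) * χ c₁) * χ g₀ := by
    rw [mul_assoc, ← map_mul, ← hc₁, hχψ, hn₁T, ← mul_assoc, inl_mul_inl, IsUnit.val_inv_mul, inl_one, one_mul]
  -- the computation in `T`
  have hπ0 : mkR π = 0 := tsze_eq_zero_of_inr_one_eq_mul hJ2 (hfstJ g₀ hg₀mem) hεT hπT
  rw [hmkR, Ideal.Quotient.eq_zero_iff_mem] at hπ0
  exact hπ2 hπ0

end Summit.ResolutionOfSingularities.ResolutionOfSingularities.Theorems.RadicialJung.CleanModels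

end
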